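import Mathlib
import Summits.BirchSwinnertonDyer.BirchSwinnertonDyer.Theorems.ResidualThetaTransportAtTwoSignedMuSeedAtTwoPlusNonsquareDescentGrowthCertificate
import Literature.NumberTheory.IwasawaTheory.ClassicalMuVanishesIffBoundedRank
import HarnessLib

/-!
# Non-square descent — THE S2 COMPARISON WITH A BASE TOWER: `e_n(κ) ≤ e_n(κ') + ord_p #(Q'/ω_nQ') + C`, `μ(κ') = 0`, `μ(Q') = 0 ⟹ μ(κ) = 0`
# (growth form, `hI`-free) and the numeric glue of the index theorem `[ℰ : 𝒞] = c·h` (line `nonsquare-descent`, stub S2) — seed crux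
# `SignedMuSeedAtTwoPlus` stmt-BirchSwinnertonDyer-21438 (parent Kμ⁺ `SignedMuVanishingAtTwoPlus` stmt-BirchSwinnertonDyer-20689, route
# ResidualThetaTransportAtTwo), line card `Cruxes/SignedMuSeedAtTwoPlus/Lines/nonsquare-descent.md`

Cell `bsd-wall`, width seat `bsd-wall-rtt-p4-w2` g19 (`--supports`, closes nothing).  THEOREMS ONLY; BSD is not proved by this and nothing
arithmetic is asserted.

g18's `…GrowthOfCertificate.classicalMuVanishes_of_comparison` closes S2's «`μ(X^χ) ≤ μ(Q')`» in tree currency from the comparison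
`e_n(κ) ≤ ord_p #(M/ω_nM) + C` (with `M = Q'`).  For the seed, `κ` is the cyclotomic `ℤ₂`-extension of `M = ℚ(W[2]) = K·L` and the natural
comparison has a BASE term: `ord₂ h(M_n) = ord₂ h(K_n) + ord₂ #A_n^χ` (`A(M_n)[2^∞]^Δ ≅ A(K_n)[2^∞]`, `3 ∈ ℤ₂ˣ` — `…IsotypicIndex`) and
`ord₂ #A_n^χ ≤ ord₂ #B'_n + C₁ ≤ ord₂ [𝓔_n^χ : 𝒩_n] + ord₂ #(Q'/ω_nQ') + C₁` (index theorem ∘ `…NormIndexSplit` ∘ this seat's Herbrand/capitulation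
chain), while `μ(K^{cyc}/K) = 0` (Ferrero–Washington, `K` abelian over `ℚ`).  So the closer a LEAD needs is:

* **`classicalMuVanishes_of_comparison_with_base`** — `M` as in g18 (f.g. over `R` with `(p) ⊆ Jac R`, «μ = 0» input `T^{N₀}M ⊆ pM`, bounded
  `p`-power torsion, finite `M/ω_nM`), a `ℤ_p`-extension `κ'` with `ClassicalMuVanishes κ'`, and
  `e_n(κ) ≤ e_n(κ') + ord_p #(M/ω_nM) + C` for `n ≫ 0` ⟹ `ClassicalMuVanishes κ` — via g18's `padicValNat_natCard_quotient_omega_linear` and the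
  tree's `hI`-free `classicalMuVanishes_of_classNumberPExp_le_linear'` (no `iwasawa1959_classNumberPExp_growth` hypothesis);
  `classicalMuVanishes_of_le_add_linear` (the bare form: `e_n(κ) ≤ e_n(κ') + (d n + b)` ⟹ `μ(κ) = 0`).
* numeric glue for the TYPED index theorem `Oukhaba2007.thm_index_eq_mul_classNumber_of_isCyclotomic` (`[ℰ_{F_n} : 𝒞_{F_n}] = c · h_{F_n}`, `c ∈ ℚˣ`
  constant): **`padicValNat_cast_eq_of_eq_mul`** (`(a : ℚ) = c·b`, `b, c` non-zero ⟹ `ord_p a = ord_p c + ord_p b` in `ℤ`), `padicValNat_le_of_eq_mul` /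
  `padicValNat_le_of_eq_mul'` (`ord_p b ≤ ord_p a + ⌈|ord_p c|⌉` and conversely: the index and the class number have the same `p`-adic order up to a
  constant).

[folklore]
-/

set_option autoImplicit false
-- the Theorems namespace of this sub repeats the summit name by design (D-0017 nested layout)
set_option linter.dupNamespace false

open Literature.NumberTheory.IwasawaTheory Literature.NumberTheory.EllipticCurves

namespace Summit.BirchSwinnertonDyer.BirchSwinnertonDyer.Theorems.SignedMuAtTwo.NonsquareDescent

/-! ## §1 `μ = 0` from a comparison with a base tower of `μ = 0` plus a linear term -/

section Base

variable {p : ℕ} [Fact p.Prime] {K : Type} [Field K] [NumberField K] {K' : Type} [Field K']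

/-- **`e_n(κ) ≤ e_n(κ') + (d n + b)` for `n ≫ 0` and `μ(κ') = 0` ⟹ `μ(κ) = 0`** (growth forms; `hI`-free). [folklore] -/
theorem classicalMuVanishes_of_le_add_linear (κ : ZpExtension K p) (κ' : ZpExtension K' p) (hκ' : ClassicalMuVanishes κ')
    {d b n₀ : ℕ} (hle : ∀ n, n₀ ≤ n → classNumberPExp κ n ≤ classNumberPExp κ' n + (d * n + b)) :
    ClassicalMuVanishes κ := by
  obtain ⟨l, ν, n₁, hl⟩ := hκ'
  refine classicalMuVanishes_of_classNumberPExp_le_linear' κ (a := l + d) (b := ν.natAbs + b) (n₁ := max n₀ n₁) fun n hn => ?_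
  have h1 := hle n (le_trans (le_max_left _ _) hn)
  have h2 := hl n (le_trans (le_max_right _ _) hn)
  have h3 : classNumberPExp κ' n ≤ l * n + ν.natAbs := by
    have : (classNumberPExp κ' n : ℤ) ≤ l * n + (ν.natAbs : ℤ) := by
      rw [h2]
      have hν : ν ≤ (ν.natAbs : ℤ) := Int.le_natAbs
      omega
    exact_mod_cast this
  calc classNumberPExp κ n ≤ classNumberPExp κ' n + (d * n + b) := h1
    _ ≤ (l * n + ν.natAbs) + (d * n + b) := Nat.add_le_add_right h3 _
    _ = (l + d) * n + (ν.natAbs + b) := by ring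

variable {R : Type*} [CommRing R] {M : Type*} [AddCommGroup M] [Module R M]

/-- **THE S2 CLOSER WITH A BASE TOWER**: `M` finitely generated over `R` with `(p) ⊆ Jac R`, `T^{N₀}M ⊆ pM` («`μ(Q') = 0`», the S3 (c)
certificate's output), bounded `p`-power torsion and finite layers `M/ω_nM` (`ω_n = (1+T)^{pⁿ} − 1`); a `ℤ_p`-extension `κ'` with `μ = 0` (growth
form); and the ARITHMETIC comparison `e_n(κ) ≤ e_n(κ') + ord_p #(M/ω_nM) + C` for `n ≫ 0`.  Then `μ(κ) = 0` in growth form.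
(«`μ₂(M^{cyc}/M) = 0` from `μ₂(K^{cyc}/K) = 0`, the index theorem, the Herbrand/capitulation bound and `μ(Q') = 0`».) [folklore] -/
theorem classicalMuVanishes_of_comparison_with_base [Module.Finite R M] (T : R)
    (hjac : Ideal.span {(p : R)} ≤ (⊥ : Ideal R).jacobson) (N₀ : ℕ)
    (hT : Ideal.span {T ^ N₀} • (⊤ : Submodule R M) ≤ Ideal.span {(p : R)} • ⊤)
    (k : ℕ) (htor : ∀ (x : M) (i : ℕ), ((p : R) ^ i) • x = 0 → ((p : R) ^ k) • x = 0)
    (hfin : ∀ n : ℕ, Finite (M ⧸ Ideal.span {(1 + T) ^ (p ^ n) - 1} • (⊤ : Submodule R M)))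
    (κ : ZpExtension K p) (κ' : ZpExtension K' p) (hκ' : ClassicalMuVanishes κ') {C n₃ : ℕ}
    (hcmp : ∀ n : ℕ, n₃ ≤ n → classNumberPExp κ n ≤ classNumberPExp κ' n +
      padicValNat p (Nat.card (M ⧸ Ideal.span {(1 + T) ^ (p ^ n) - 1} • (⊤ : Submodule R M))) + C) :
    ClassicalMuVanishes κ := by
  obtain ⟨n₂, d, b, hlin⟩ := padicValNat_natCard_quotient_omega_linear p T hjac N₀ hT k htor hfin
  refine classicalMuVanishes_of_le_add_linear κ κ' hκ' (d := d) (b := b + C) (n₀ := max n₂ n₃) fun n hn => ?_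
  have h1 := hcmp n (le_trans (le_max_right _ _) hn)
  have h2 := hlin n (le_trans (le_max_left _ _) hn)
  rw [h2] at h1
  have h3 : d * (n - n₂) ≤ d * n := Nat.mul_le_mul_left d (Nat.sub_le n n₂)
  calc classNumberPExp κ n ≤ classNumberPExp κ' n + (d * (n - n₂) + b) + C := h1
    _ ≤ classNumberPExp κ' n + (d * n + b) + C := by
        exact Nat.add_le_add_right (Nat.add_le_add_left (Nat.add_le_add_right h3 b) _) C
    _ = classNumberPExp κ' n + (d * n + (b + C)) := by ring

end Base

/-! ## §2 Numeric glue for `[ℰ : 𝒞] = c · h` -/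

section IndexGlue

variable {p : ℕ} [Fact p.Prime]

/-- **`(a : ℚ) = c · b` with `b ≠ 0`, `c ≠ 0` ⟹ `ord_p a = ord_p c + ord_p b`** (in `ℤ`; `ord_p c = padicValRat p c`).
(«`ord_p [ℰ_{F_n} : 𝒞_{F_n}] = ord_p c + ord_p h_{F_n}`» from `Oukhaba2007.thm_index_eq_mul_classNumber_of_isCyclotomic`.) [folklore] -/
theorem padicValNat_cast_eq_of_eq_mul {a b : ℕ} {c : ℚ} (hb : b ≠ 0) (hc : c ≠ 0) (h : (a : ℚ) = c * b) :
    (padicValNat p a : ℤ) = padicValRat p c + padicValNat p b := by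
  have hbq : (b : ℚ) ≠ 0 := Nat.cast_ne_zero.2 hb
  rw [padicValRat_of_nat, padicValRat_of_nat, h, padicValRat.mul hc hbq, padicValRat.of_nat]

/-- Hence `ord_p b ≤ ord_p a + ⌈|ord_p c|⌉` — the class number's `p`-order is the index's up to a constant. [folklore] -/
theorem padicValNat_le_of_eq_mul {a b : ℕ} {c : ℚ} (hb : b ≠ 0) (hc : c ≠ 0) (h : (a : ℚ) = c * b) :
    padicValNat p b ≤ padicValNat p a + (padicValRat p c).natAbs := by
  have key := padicValNat_cast_eq_of_eq_mul (p := p) hb hc h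
  have : (padicValNat p b : ℤ) ≤ padicValNat p a + ((padicValRat p c).natAbs : ℤ) := by
    rw [key]
    have h1 := Int.le_natAbs (a := -padicValRat p c)
    rw [Int.natAbs_neg] at h1
    omega
  exact_mod_cast this

/-- … and `ord_p a ≤ ord_p b + ⌈|ord_p c|⌉`. [folklore] -/
theorem padicValNat_le_of_eq_mul' {a b : ℕ} {c : ℚ} (hb : b ≠ 0) (hc : c ≠ 0) (h : (a : ℚ) = c * b) :
    padicValNat p a ≤ padicValNat p b + (padicValRat p c).natAbs := by
  have key := padicValNat_cast_eq_of_eq_mul (p := p) hb hc h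
  have : (padicValNat p a : ℤ) ≤ padicValNat p b + ((padicValRat p c).natAbs : ℤ) := by
    rw [key]
    have := Int.le_natAbs (a := padicValRat p c)
    omega
  exact_mod_cast this

end IndexGlue

end Summit.BirchSwinnertonDyer.BirchSwinnertonDyer.Theorems.SignedMuAtTwo.NonsquareDescent
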